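import Summits.Ventures.Crystal3D.Theorems.StickyWulffConstantTextureBuildContactRows
import Summits.Ventures.Crystal3D.Theorems.StickyWulffConstantTextureBuildCutSpecials
import HarnessLib

/-!
# TB-energy blueprint, the SPECIAL contacts (cut ∪ curtain), the riser package's contact row `BoxRow`, and (L-P2) / (L-S) modulo the riser package
# (lane T, crux `TextureLiminfV5`, stmt-Ventures-23912; TB-D-3-g20 §LP2/§LS; memo HOME/wulff-p2/g21/TB-D-4-g21.md)

HONEST FRAMING. Venture `Summits/Ventures/Crystal3D` (cell `crystal3d-full`), route `route-Ventures-StickyWulffConstant`, helper `--supports` the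
law-v5 crux `TextureLiminfV5` (stmt-Ventures-23912).  DEFINITIONS (the special contacts and their sums; the riser package's row as a named `Prop`
with parameters) + bookkeeping (standard axioms; no mesh constructed; F-C1 not moved).  Nothing is proved about riser boxes here: the two riser-package
obligations are HYPOTHESES (`BoxRow`, the curtain bound) consumed by name.

* `IsSpecial` = `IsCutSpecial ∨ IsCurtainSpecial` (cut plane of a prism texture-cell / vertical plane inside a riser box), `specialSum`, `curtainSpecialSum`,
  `specialSum_le_cut_add_curtain`;
* **`BoxRow`** — THE RISER PACKAGE'S CONTACT ROW (B6 interface, pointwise): at a generic non-designated contact point of two pieces of DIFFERENT grains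
  with a riser-box cell on either side, the contact is a curtain special or free;
* **`lp2_of_boxRow`** — (L-P2) of the blueprint for EVERY pair: same grain ⇒ free (…ContactRows), non-box pairs ⇒ `lp2_nonbox`, box pairs ⇒ `BoxRow`;
* **`ls_of_curtain`** — (L-S): `specialSum ≤ chargeSum + 13/25·Σ ex + riserSum` from `Good.hcut`-type Cavalieri data (…CutSpecials) and the curtain bound.
-/

noncomputable section

open scoped BigOperators InnerProductSpace ENNReal
open MeasureTheory Set

namespace Summit.Ventures.Crystal3D.Cruxes.TextureLiminf.TexShadow

open Summit.Ventures.Crystal3D Summit.Ventures.Crystal3D.Theorems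

/-- Union bound for sums of nonnegative terms. -/
private theorem sum_union_le_of_nonneg'' {α : Type*} [DecidableEq α] (A B : Finset α) (f : α → ℝ) (hf : ∀ a, 0 ≤ f a) :
    ∑ a ∈ A ∪ B, f a ≤ ∑ a ∈ A, f a + ∑ a ∈ B, f a := by
  rw [← Finset.union_sdiff_self_eq_union, Finset.sum_union Finset.disjoint_sdiff]
  have h : ∑ a ∈ B \ A, f a ≤ ∑ a ∈ B, f a := Finset.sum_le_sum_of_subset_of_nonneg Finset.sdiff_subset fun a _ _ => hf a
  linarith

namespace TexInput

variable {C R₀ : ℝ} {N : ℕ} {x : Fin N → E3} {rc : RiseredCover C R₀ N x} {δ : ℝ} {μ : Mesh₅ rc δ} (I : TexInput rc μ)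

/-! ### Special contacts -/

/-- **CURTAIN special**: both pieces inside ONE riser box, the contact across a plane orthogonal to the riser's layer normal. -/
def IsCurtainSpecial (i i' : Fin I.cells.M) (p : E3 × ℝ) : Prop :=
  ∃ r : Fin rc.nr, polytope (I.cells.Hp i) ⊆ polytope (μ.HB r) ∧ polytope (I.cells.Hp i') ⊆ polytope (μ.HB r) ∧ ⟪p.1, rc.rn r⟫_ℝ = 0

/-- **SPECIAL contacts**: cut specials (…CutSpecials) or curtain specials. -/
def IsSpecial (i i' : Fin I.cells.M) (p : E3 × ℝ) : Prop := I.IsCutSpecial i i' p ∨ I.IsCurtainSpecial i i' p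

open scoped Classical in
/-- the total weight of the special contacts (both halves of the ledger) -/
def specialSum : ℝ :=
  ∑ i, ∑ i' ∈ Finset.univ.filter (fun i' => I.cells.cls i' ≠ I.cells.cls i),
    ∑ p ∈ (I.cells.Hp i).filter (fun p => I.IsSpecial i i' p),
      lawW I.frameOf (I.cells.cls i) (I.cells.cls i') p.1 * facetArea (I.contact i i' p) p.1

open scoped Classical in
/-- the total weight of the curtain specials (both halves) -/
def curtainSpecialSum : ℝ :=
  ∑ i, ∑ i' ∈ Finset.univ.filter (fun i' => I.cells.cls i' ≠ I.cells.cls i),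
    ∑ p ∈ (I.cells.Hp i).filter (fun p => I.IsCurtainSpecial i i' p),
      lawW I.frameOf (I.cells.cls i) (I.cells.cls i') p.1 * facetArea (I.contact i i' p) p.1

open scoped Classical in
/-- **The specials split**: `specialSum ≤ cutSpecialSum + curtainSpecialSum`. -/
theorem specialSum_le_cut_add_curtain : I.specialSum ≤ I.cutSpecialSum + I.curtainSpecialSum := by
  unfold specialSum cutSpecialSum curtainSpecialSum
  rw [← Finset.sum_add_distrib]
  refine Finset.sum_le_sum fun i _ => ?_
  rw [← Finset.sum_add_distrib]
  refine Finset.sum_le_sum fun i' _ => ?_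
  have hg : ∀ p : E3 × ℝ, 0 ≤ lawW I.frameOf (I.cells.cls i) (I.cells.cls i') p.1 * facetArea (I.contact i i' p) p.1 :=
    fun p => mul_nonneg (lawW_nonneg _ _ _ _) (facetArea_nonneg _ _)
  have hsub : (I.cells.Hp i).filter (fun p => I.IsSpecial i i' p) ⊆
      (I.cells.Hp i).filter (fun p => I.IsCutSpecial i i' p) ∪ (I.cells.Hp i).filter (fun p => I.IsCurtainSpecial i i' p) := by
    intro p hp
    obtain ⟨hpH, hsp⟩ := Finset.mem_filter.1 hp
    rcases hsp with h | h
    · exact Finset.mem_union_left _ (Finset.mem_filter.2 ⟨hpH, h⟩)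
    · exact Finset.mem_union_right _ (Finset.mem_filter.2 ⟨hpH, h⟩)
  exact (Finset.sum_le_sum_of_subset_of_nonneg hsub (fun p _ _ => hg p)).trans (sum_union_le_of_nonneg'' _ _ _ hg)

/-! ### The riser package's contact row -/

/-- **THE RISER PACKAGE'S CONTACT ROW** (B6 interface): at a GENERIC contact point outside the designated regions, two pieces of DIFFERENT grains one of
which is a riser-box cell touch across a curtain special or a free plane.  (With the claim rule of TB-D-1 §1(R): curtains are the vertical walls between
differently claimed small-triangle prisms, horizontal planes are free by the shared axis `rn r`, and box facets are same-grain by `hBmatch₅`'s completeness.) -/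
def BoxRow : Prop :=
  ∀ i i' : Fin I.cells.M, I.grain i' ≠ I.grain i →
    ((∃ r, polytope (I.cells.Hp i) ⊆ polytope (μ.HB r)) ∨ (∃ r, polytope (I.cells.Hp i') ⊆ polytope (μ.HB r))) →
    ∀ p ∈ I.cells.Hp i, ∀ y ∈ I.contact i i' p, I.Generic p y → y ∉ μ.desOf₂ p →
      I.IsCurtainSpecial i i' p ∨ lawW I.frameOf (I.cells.cls i) (I.cells.cls i') p.1 = 0

open scoped Classical in
/-- **(L-P2) OF THE BLUEPRINT FOR EVERY PAIR, from the rows and the riser package's row**: a cross-class contact is special, or free, or a.e. inside the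
designated regions of either orientation (the `hP2` hypothesis of `wall_le_split`, verbatim). -/
theorem lp2_of_boxRow (hτ : ∀ k, I.τ k ∈ Set.Ioo (0 : ℝ) 1) (hR₀ : 1 ≤ R₀) (hbox : I.BoxRow) :
    ∀ i i', I.cells.cls i' ≠ I.cells.cls i → ∀ p ∈ I.cells.Hp i,
      I.IsSpecial i i' p ∨ lawW I.frameOf (I.cells.cls i) (I.cells.cls i') p.1 = 0 ∨
        facetArea ((closure (polytope (I.cells.Hp i)) ∩ {y : E3 | ⟪p.1, y⟫_ℝ = p.2} ∩ closure (polytope (I.cells.Hp i'))) \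
          ⋃ d ∈ μ.desSet.filter (fun d => (d.2.1, d.2.2) = p ∨ (-d.2.1, -d.2.2) = p), facetOf d.1 d.2) p.1 = 0 := by
  intro i i' hcls p hp
  show I.IsSpecial i i' p ∨ lawW I.frameOf (I.cells.cls i) (I.cells.cls i') p.1 = 0 ∨ facetArea (I.contact i i' p \ μ.desOf₂ p) p.1 = 0
  by_cases hb : (∃ r, polytope (I.cells.Hp i) ⊆ polytope (μ.HB r)) ∨ (∃ r, polytope (I.cells.Hp i') ⊆ polytope (μ.HB r))
  · rw [← or_assoc]
    refine I.classify_of_point hp fun y hy hgen hnd => ?_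
    by_cases hg : I.grain i' = I.grain i
    · exact Or.inr (I.lawW_eq_zero_of_grain_eq hcls hg hy hgen)
    · rcases hbox i i' hg hb p hp y hy hgen hnd with h | h
      · exact Or.inl (Or.inr h)
      · exact Or.inr h
  · push Not at hb
    rcases I.lp2_nonbox hτ hR₀ hcls hb.1 hb.2 hp with ⟨k, hi, hi', hpk⟩ | h | h
    · exact Or.inl (Or.inl ⟨k, hi, hi', hpk⟩)
    · exact Or.inr (Or.inl h)
    · exact Or.inr (Or.inr h)

/-! ### (L-S) modulo the curtain bound -/

/-- **(L-S) = (L-C) + (L-R)**: the special contacts are paid by the cells' charges (+ slice excess, from the Cavalieri clause of the cut levels) and the riser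
budget (the curtain bound, the riser package's). -/
theorem ls_of_curtain
    (hcut : ∀ (k : Fin rc.nk) (F : Finset (ℤ × ℤ)),
      ∑ ij ∈ F, (rc.cell k).c ij.1 ij.2 * facetArea (closure (polytope (μ.HP k)) ∩
        closure (laySlab (rc.tent (μ.fk k)).L (rc.tent (μ.fk k)).s ij.1) ∩ closure (laySlab (rc.tent (μ.gk k)).L (rc.tent (μ.gk k)).s ij.2) ∩
        {y : E3 | ⟪(I.cutDatum k).1, y⟫_ℝ = (I.cutDatum k).2}) (I.cutDatum k).1 ≤ (rc.cell k).charge + 13 / 25 * μ.ex k)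
    (hcurtain : I.curtainSpecialSum ≤ rc.riserSum) :
    I.specialSum ≤ rc.chargeSum + 13 / 25 * ∑ k, μ.ex k + rc.riserSum := by
  have h1 := I.specialSum_le_cut_add_curtain
  have h2 := I.cutSpecialSum_le hcut
  linarith

end TexInput

end Summit.Ventures.Crystal3D.Cruxes.TextureLiminf.TexShadow

end
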